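import Summits.Ventures.CertifiedArithmetic.LowPrec.PatternEnvelopeAdd

/-!
# Pattern route of Theorem E5, part 4b: the sum constants of the four roundings are sound and
# sharp

HONEST FRAMING (venture CertifiedArithmetic / cell `pub-lowprec`): certified error envelopes and
provably optimal rounding/accumulation schemes for low-precision formats under stated cost models;
every table by two implementations; no hardware or vendor claims.

THEOREMS-R1 Theorem E5, bookkeeping half, sums `X + Y → R` (any three binary formats): the
schemas of `PatternEnvelopeAdd.lean` instantiated with the pattern bridges of
`PatternBridge.lean` for the four roundings of the enumeration tables (the sum analogue of
`PatternEnvelopeMulModes.lean`). For EVERY `X, Y, R`: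
* nearest — `|RNE(a+b) - (a+b)| ≤ envconstAddNE X Y R · |a+b|` on the normal range of `R`,
  attained (`add_relNE_le_envconst`, `add_relNE_attained`);
* toward zero — constant `envconstAddTZ X Y R` (`add_relTZ_le_envconst`, `add_relTZ_attained`);
* round down and round up — ONE constant `envconstAddDir X Y R` for both columns (toward-zero
  pattern error on one sign of the sum, away error on the other; both signs of every sum pattern
  are realisable: `add_relRD/RU_le_envconst`, `add_relRD/RU_attained`), the pattern-level form
  of `c_RD = c_RU = max(c_towardzero, c_away)` (`DirectedRDColumn.lean`).
The corollaries `add_relNE/TZ/RD/RU_normal_of_envconst` put a computed constant into the exact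
shape of the kernel-exhaustive table theorems (`EnvelopesDirected*.lean`), so that a
per-key theorem costs `decide`s on pattern-level quantities and no operand-pair enumeration
(`PatternEnvelopeAddFP6FP4.lean`).

Placement: venture development under `Summits/Ventures/CertifiedArithmetic/`; declarations extend
the Literature structure `MiniFloat` (CONVENTIONS §2). New work of the venture (elementary;
[folklore] tags, cf. [cite: Higham2002ASNA, §2.1]).
-/

namespace Literature.ComputerArithmetic.FloatingPoint

open Format

namespace MiniFloat

variable {X Y : Format}

/-! ### The four roundings -/

/-- SOUNDNESS, NEAREST: on the normal range of `R`, `|RNE(a+b) - (a+b)| ≤ envconstAddNE X Y R · |a+b|`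
for all data `a : X`, `b : Y`. [folklore] -/
theorem add_relNE_le_envconst (R : Format) (a : MiniFloat X) (b : MiniFloat Y)
    (hlo : 2 ^ R.manBits * R.quantum ≤ |a.toRat + b.toRat|)
    (hhi : |a.toRat + b.toRat| ≤ R.maxRat) :
    |(roundNE R (a.toRat + b.toRat)).toRat - (a.toRat + b.toRat)|
      ≤ envconstAddNE X Y R * |a.toRat + b.toRat| :=
  add_rel_le_of_bridge R (roundNE R) patRelErrNE
    (fun _ _ _ hF ht hlo hhi => (relErr_roundNE_of_scaled hF ht hlo hhi).le) a b hlo hhi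

/-- ATTAINMENT, NEAREST: `envconstAddNE X Y R` is attained by an in-range sum. [folklore] -/
theorem add_relNE_attained (R : Format) (hne : addPatErrs patRelErrNE X Y R ≠ []) :
    ∃ (a : MiniFloat X) (b : MiniFloat Y), 2 ^ R.manBits * R.quantum ≤ |a.toRat + b.toRat| ∧
      |a.toRat + b.toRat| ≤ R.maxRat ∧
      |(roundNE R (a.toRat + b.toRat)).toRat - (a.toRat + b.toRat)|
        = envconstAddNE X Y R * |a.toRat + b.toRat| :=
  add_rel_attained_of_bridge R (roundNE R) patRelErrNE (fun _ => false)
    (fun N => patRelErrNE_nonneg _ N)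
    (fun _ _ _ _ _ hF ht hlo hhi => relErr_roundNE_of_scaled hF ht hlo hhi) hne

/-- SOUNDNESS, TOWARD ZERO: `|RZ(a+b) - (a+b)| ≤ envconstAddTZ X Y R · |a+b|` on the normal range.
[folklore] -/
theorem add_relTZ_le_envconst (R : Format) (a : MiniFloat X) (b : MiniFloat Y)
    (hlo : 2 ^ R.manBits * R.quantum ≤ |a.toRat + b.toRat|)
    (hhi : |a.toRat + b.toRat| ≤ R.maxRat) :
    |(roundTowardZero R (a.toRat + b.toRat)).toRat - (a.toRat + b.toRat)|
      ≤ envconstAddTZ X Y R * |a.toRat + b.toRat| :=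
  add_rel_le_of_bridge R (roundTowardZero R) patRelErrTZ
    (fun _ _ _ hF ht hlo hhi => (relErr_roundTowardZero_of_scaled hF ht hlo hhi).le) a b hlo hhi

/-- ATTAINMENT, TOWARD ZERO. [folklore] -/
theorem add_relTZ_attained (R : Format) (hne : addPatErrs patRelErrTZ X Y R ≠ []) :
    ∃ (a : MiniFloat X) (b : MiniFloat Y), 2 ^ R.manBits * R.quantum ≤ |a.toRat + b.toRat| ∧
      |a.toRat + b.toRat| ≤ R.maxRat ∧
      |(roundTowardZero R (a.toRat + b.toRat)).toRat - (a.toRat + b.toRat)|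
        = envconstAddTZ X Y R * |a.toRat + b.toRat| :=
  add_rel_attained_of_bridge R (roundTowardZero R) patRelErrTZ (fun _ => false)
    (fun N => patRelErrTZ_nonneg _ N)
    (fun _ _ _ _ _ hF ht hlo hhi => relErr_roundTowardZero_of_scaled hF ht hlo hhi) hne

/-- SOUNDNESS, ROUND DOWN: `|RD(a+b) - (a+b)| ≤ envconstAddDir X Y R · |a+b|` on the normal range
(toward-zero pattern error at `a+b > 0`, away error at `a+b < 0`). [folklore] -/
theorem add_relRD_le_envconst (R : Format) (a : MiniFloat X) (b : MiniFloat Y)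
    (hlo : 2 ^ R.manBits * R.quantum ≤ |a.toRat + b.toRat|)
    (hhi : |a.toRat + b.toRat| ≤ R.maxRat) :
    |(roundDown R (a.toRat + b.toRat)).toRat - (a.toRat + b.toRat)|
      ≤ envconstAddDir X Y R * |a.toRat + b.toRat| :=
  add_rel_le_of_bridge R (roundDown R) patRelErrDir
    (fun t _ _ hF ht hlo hhi => by
      rcases lt_or_gt_of_ne (ne_zero_of_normal hlo) with hneg | hpos
      · rw [relErr_roundDown_of_scaled_neg hneg hF ht hlo hhi]; exact le_max_right _ _
      · rw [relErr_roundDown_of_scaled_pos hpos hF ht hlo hhi]; exact le_max_left _ _) a b hlo hhi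

/-- ATTAINMENT, ROUND DOWN (at a negative sum when the away error of the maximising pattern
exceeds its toward-zero error, else at a positive one). [folklore] -/
theorem add_relRD_attained (R : Format) (hne : addPatErrs patRelErrDir X Y R ≠ []) :
    ∃ (a : MiniFloat X) (b : MiniFloat Y), 2 ^ R.manBits * R.quantum ≤ |a.toRat + b.toRat| ∧
      |a.toRat + b.toRat| ≤ R.maxRat ∧
      |(roundDown R (a.toRat + b.toRat)).toRat - (a.toRat + b.toRat)|
        = envconstAddDir X Y R * |a.toRat + b.toRat| :=
  add_rel_attained_of_bridge R (roundDown R) patRelErrDir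
    (fun N => decide (R.patRelErrTZ (addFuel X Y) N < R.patRelErrAW (addFuel X Y) N))
    (fun N => patRelErrDir_nonneg _ N)
    (fun t N _ hne0 hsgn hF ht hlo hhi => by
      by_cases h : R.patRelErrTZ (addFuel X Y) N < R.patRelErrAW (addFuel X Y) N
      · rw [relErr_roundDown_of_scaled_neg (hsgn.mpr (decide_eq_true h)) hF ht hlo hhi]
        exact (max_eq_right h.le).symm
      · have hpos : 0 < t := by
          rcases lt_or_gt_of_ne hne0 with hneg | hpos
          · exact absurd (of_decide_eq_true (hsgn.mp hneg)) h
          · exact hpos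
        rw [relErr_roundDown_of_scaled_pos hpos hF ht hlo hhi]
        exact (max_eq_left (not_lt.mp h)).symm) hne

/-- SOUNDNESS, ROUND UP: the same constant `envconstAddDir X Y R` (mirror image of round down).
[folklore] -/
theorem add_relRU_le_envconst (R : Format) (a : MiniFloat X) (b : MiniFloat Y)
    (hlo : 2 ^ R.manBits * R.quantum ≤ |a.toRat + b.toRat|)
    (hhi : |a.toRat + b.toRat| ≤ R.maxRat) :
    |(roundUp R (a.toRat + b.toRat)).toRat - (a.toRat + b.toRat)|
      ≤ envconstAddDir X Y R * |a.toRat + b.toRat| :=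
  add_rel_le_of_bridge R (roundUp R) patRelErrDir
    (fun t _ _ hF ht hlo hhi => by
      rcases lt_or_gt_of_ne (ne_zero_of_normal hlo) with hneg | hpos
      · rw [relErr_roundUp_of_scaled_neg hneg hF ht hlo hhi]; exact le_max_left _ _
      · rw [relErr_roundUp_of_scaled_pos hpos hF ht hlo hhi]; exact le_max_right _ _) a b hlo hhi

/-- ATTAINMENT, ROUND UP. [folklore] -/
theorem add_relRU_attained (R : Format) (hne : addPatErrs patRelErrDir X Y R ≠ []) :
    ∃ (a : MiniFloat X) (b : MiniFloat Y), 2 ^ R.manBits * R.quantum ≤ |a.toRat + b.toRat| ∧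
      |a.toRat + b.toRat| ≤ R.maxRat ∧
      |(roundUp R (a.toRat + b.toRat)).toRat - (a.toRat + b.toRat)|
        = envconstAddDir X Y R * |a.toRat + b.toRat| :=
  add_rel_attained_of_bridge R (roundUp R) patRelErrDir
    (fun N => decide (R.patRelErrAW (addFuel X Y) N < R.patRelErrTZ (addFuel X Y) N))
    (fun N => patRelErrDir_nonneg _ N)
    (fun t N _ hne0 hsgn hF ht hlo hhi => by
      by_cases h : R.patRelErrAW (addFuel X Y) N < R.patRelErrTZ (addFuel X Y) N
      · rw [relErr_roundUp_of_scaled_neg (hsgn.mpr (decide_eq_true h)) hF ht hlo hhi]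
        exact (max_eq_left h.le).symm
      · have hpos : 0 < t := by
          rcases lt_or_gt_of_ne hne0 with hneg | hpos
          · exact absurd (of_decide_eq_true (hsgn.mp hneg)) h
          · exact hpos
        rw [relErr_roundUp_of_scaled_pos hpos hF ht hlo hhi]
        exact (max_eq_right (not_lt.mp h)).symm) hne

/-! ### Table shape: a computed constant gives the per-key theorem -/

/-- TABLE SHAPE, NEAREST: from `2^m · quantum_R = lo`, `envconstAddNE X Y R = c` and one placeable
pattern, the per-key statement "bound `c` on `lo ≤ |t| ≤ maxRat` over all operand pairs, and a
maximiser". [folklore] -/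
theorem add_relNE_normal_of_envconst (R : Format) {lo c : ℚ}
    (hlo : 2 ^ R.manBits * R.quantum = lo) (hc : envconstAddNE X Y R = c)
    (hne : addPatErrs patRelErrNE X Y R ≠ []) :
    (∀ (a : MiniFloat X) (b : MiniFloat Y), lo ≤ |a.toRat + b.toRat| →
        |a.toRat + b.toRat| ≤ R.maxRat →
          |(roundNE R (a.toRat + b.toRat)).toRat - (a.toRat + b.toRat)|
            ≤ c * |a.toRat + b.toRat|) ∧
      ∃ (a : MiniFloat X) (b : MiniFloat Y), lo ≤ |a.toRat + b.toRat| ∧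
        |a.toRat + b.toRat| ≤ R.maxRat ∧
          |(roundNE R (a.toRat + b.toRat)).toRat - (a.toRat + b.toRat)|
            = c * |a.toRat + b.toRat| := by
  subst hlo hc
  exact ⟨fun a b h1 h2 => add_relNE_le_envconst R a b h1 h2, add_relNE_attained R hne⟩

/-- TABLE SHAPE, TOWARD ZERO. [folklore] -/
theorem add_relTZ_normal_of_envconst (R : Format) {lo c : ℚ}
    (hlo : 2 ^ R.manBits * R.quantum = lo) (hc : envconstAddTZ X Y R = c)
    (hne : addPatErrs patRelErrTZ X Y R ≠ []) :
    (∀ (a : MiniFloat X) (b : MiniFloat Y), lo ≤ |a.toRat + b.toRat| →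
        |a.toRat + b.toRat| ≤ R.maxRat →
          |(roundTowardZero R (a.toRat + b.toRat)).toRat - (a.toRat + b.toRat)|
            ≤ c * |a.toRat + b.toRat|) ∧
      ∃ (a : MiniFloat X) (b : MiniFloat Y), lo ≤ |a.toRat + b.toRat| ∧
        |a.toRat + b.toRat| ≤ R.maxRat ∧
          |(roundTowardZero R (a.toRat + b.toRat)).toRat - (a.toRat + b.toRat)|
            = c * |a.toRat + b.toRat| := by
  subst hlo hc
  exact ⟨fun a b h1 h2 => add_relTZ_le_envconst R a b h1 h2, add_relTZ_attained R hne⟩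

/-- TABLE SHAPE, ROUND DOWN. [folklore] -/
theorem add_relRD_normal_of_envconst (R : Format) {lo c : ℚ}
    (hlo : 2 ^ R.manBits * R.quantum = lo) (hc : envconstAddDir X Y R = c)
    (hne : addPatErrs patRelErrDir X Y R ≠ []) :
    (∀ (a : MiniFloat X) (b : MiniFloat Y), lo ≤ |a.toRat + b.toRat| →
        |a.toRat + b.toRat| ≤ R.maxRat →
          |(roundDown R (a.toRat + b.toRat)).toRat - (a.toRat + b.toRat)|
            ≤ c * |a.toRat + b.toRat|) ∧
      ∃ (a : MiniFloat X) (b : MiniFloat Y), lo ≤ |a.toRat + b.toRat| ∧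
        |a.toRat + b.toRat| ≤ R.maxRat ∧
          |(roundDown R (a.toRat + b.toRat)).toRat - (a.toRat + b.toRat)|
            = c * |a.toRat + b.toRat| := by
  subst hlo hc
  exact ⟨fun a b h1 h2 => add_relRD_le_envconst R a b h1 h2, add_relRD_attained R hne⟩

/-- TABLE SHAPE, ROUND UP. [folklore] -/
theorem add_relRU_normal_of_envconst (R : Format) {lo c : ℚ}
    (hlo : 2 ^ R.manBits * R.quantum = lo) (hc : envconstAddDir X Y R = c)
    (hne : addPatErrs patRelErrDir X Y R ≠ []) :
    (∀ (a : MiniFloat X) (b : MiniFloat Y), lo ≤ |a.toRat + b.toRat| →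
        |a.toRat + b.toRat| ≤ R.maxRat →
          |(roundUp R (a.toRat + b.toRat)).toRat - (a.toRat + b.toRat)|
            ≤ c * |a.toRat + b.toRat|) ∧
      ∃ (a : MiniFloat X) (b : MiniFloat Y), lo ≤ |a.toRat + b.toRat| ∧
        |a.toRat + b.toRat| ≤ R.maxRat ∧
          |(roundUp R (a.toRat + b.toRat)).toRat - (a.toRat + b.toRat)|
            = c * |a.toRat + b.toRat| := by
  subst hlo hc
  exact ⟨fun a b h1 h2 => add_relRU_le_envconst R a b h1 h2, add_relRU_attained R hne⟩

end MiniFloat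

end Literature.ComputerArithmetic.FloatingPoint
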